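import Mathlib

/-!
# The resolvent difference-quotient identity behind the local-Green's-function form of the read-out (solo-blind kernel #206)

If `a` and `c` are units of a ring with `a + c = μ` for a *central* unit `μ`, then
`a⁻¹ c⁻¹ = μ⁻¹ (a⁻¹ + c⁻¹)`.  Applied to `a = iω - J`, `c = J - ελ₀` (so `μ = iω - ελ₀` is a scalar) this turns the
Fourier transform of the read-out `⟨e₁, e^{BJ} V⟩` of the flux state `V = -(J - ελ₀)⁻¹ q` into a difference quotient of the
LOCAL Green's function `G(z) = ⟨e₁, (z - J)⁻¹ q⟩`:  `x̂₁(ω) = -[G(iω) - G(ελ₀)]/(iω - ελ₀)`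
(LEMMA R blueprint v2, paper/lemmaR-A5.md §7 (4)).  We record the ring identity and its pairing form.
-/

namespace Summit.AnomalousDissipation.AnomalousDissipation.Theorems

/-- Units version: `a + c = μ` with `μ` central ⇒ `μ · (a⁻¹ c⁻¹) = a⁻¹ + c⁻¹`. -/
theorem units_mul_inv_mul_inv_eq {R : Type*} [Ring R] (a c μ : Rˣ)
    (hμ : ∀ x : R, Commute (μ : R) x) (h : (a : R) + c = μ) :
    (μ : R) * ((a⁻¹ : Rˣ) * (c⁻¹ : Rˣ) : Rˣ) = (a⁻¹ : Rˣ) + (c⁻¹ : Rˣ) := by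
  have key : ((a⁻¹ : Rˣ) : R) * ((a : R) + c) * ((c⁻¹ : Rˣ) : R) = (a⁻¹ : Rˣ) + (c⁻¹ : Rˣ) := by
    rw [mul_add, add_mul, Units.inv_mul, one_mul, mul_assoc, Units.mul_inv, mul_one, add_comm]
  rw [h] at key
  rw [← key, Units.val_mul, ← mul_assoc, (hμ ((a⁻¹ : Rˣ) : R)).eq]

/-- The difference-quotient form: `a⁻¹ c⁻¹ = μ⁻¹ (a⁻¹ + c⁻¹)`. -/
theorem units_inv_mul_inv_eq_quotient {R : Type*} [Ring R] (a c μ : Rˣ)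
    (hμ : ∀ x : R, Commute (μ : R) x) (h : (a : R) + c = μ) :
    (((a⁻¹ : Rˣ) * (c⁻¹ : Rˣ) : Rˣ) : R) = ((μ⁻¹ : Rˣ) : R) * ((a⁻¹ : Rˣ) + (c⁻¹ : Rˣ)) := by
  rw [← units_mul_inv_mul_inv_eq a c μ hμ h, ← mul_assoc, Units.inv_mul, one_mul]

/-- Pairing form (the read-out): for any additive maps `ℓ` (the observable) the pairing of `a⁻¹ c⁻¹ q` is
`μ⁻¹`-times the sum of the two local Green's functions `ℓ (a⁻¹ q)` and `ℓ (c⁻¹ q)`, when `μ⁻¹` is central. -/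
theorem readout_quotient {R : Type*} [Ring R] (a c μ : Rˣ)
    (hμ : ∀ x : R, Commute (μ : R) x) (h : (a : R) + c = μ) (q : R) (ℓ : R →+ R)
    (hℓ : ∀ x : R, ℓ (((μ⁻¹ : Rˣ) : R) * x) = ((μ⁻¹ : Rˣ) : R) * ℓ x) :
    ℓ ((((a⁻¹ : Rˣ) * (c⁻¹ : Rˣ) : Rˣ) : R) * q) =
      ((μ⁻¹ : Rˣ) : R) * (ℓ (((a⁻¹ : Rˣ) : R) * q) + ℓ (((c⁻¹ : Rˣ) : R) * q)) := by
  rw [units_inv_mul_inv_eq_quotient a c μ hμ h, mul_assoc, hℓ, add_mul, map_add]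

end Summit.AnomalousDissipation.AnomalousDissipation.Theorems
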